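import Summits.QuantumFields.YangMills.Theorems.AllWindowsColdBoxDirResponseCovConfig
import Summits.QuantumFields.YangMills.Theorems.AllWindowsColdBoxLatticeShellSum

/-!
# LINE-18 v5 of crux `BulkMidWindowSU2` (stmt-QuantumFields-24006), toward half 1 of stub S4 — part 3b:
# the dipole law K1 implies the response bound K2 (`DirKernelDipoleDecay → DirResponseL1`)

Half 1 of the registered bundle stub `stub_potentialCorollaries` of LINE-18 v5 (planner ym-idea-2 g14, skeleton sha16 `3c750a3750a2f49e`) is
`DirKernelDipoleDecay → DirFreeVarLinear → DirResponseL1`.  This file proves the implication with both Props UNFOLDED (so that a by-name landing of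
the bundle can cite it verbatim; the skeleton's `plaqDist p q` is `((Σ_m |p.1 m − q.1 m| : ℤ) : ℝ)`), and WITHOUT the middle hypothesis C:
* `sum_inv_pow_four_enlargedBox_le` — the kernel-free lattice sum over the (translated) plaquettes of the enlarged box,
  `Σ_q (1 + dist(x, q))⁻⁴ ≤ 16·(1 + 80·log(2H+3))` for `x ∈ {0,…,2H}⁴` (reindex to the cube `‖w‖_∞ ≤ 2H+2` and `…LatticeShellSum`);
* `dirResponseL1_of_dipoleDecay` — **K1 ⇒ K2**: if `|K_H(p,q)| ≤ c₁(1+log H)/(1+dist)⁴` for all `H ≥ 1`, `p`, `q`, then for every `H ≥ 1` and every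
  deep base point `x` (`8|x_m − H| ≤ H`), `Σ_{e free} |E_D[circ_{(x,1,2)} · s_e]| ≤ c·H·(1+log H)²` with `c = 132·16·321·c₁`
  (part 3a `sum_abs_cov_le_kernelMass` + K1 termwise + the lattice sum + `log(2H+3) ≤ 4 + log H`).
Everything proved, no definition, standard axioms.  HONEST LABEL: helper = one half of a registered bundle stub of a critic-passed line on the R2ξ″
RECORD-rung crux 24006, conditional on the line's own K1 (`DirKernelDipoleDecay`, L, OPEN); no stub, crux, rung or summit is proved; the Clay
Yang–Mills mass gap is NOT proved by any of this.
-/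

set_option autoImplicit false

noncomputable section

open MeasureTheory Finset
open Literature.Probability.LatticeModels (Site mem_halfOpenBox halfOpenBox)
open Literature.MathematicalPhysics.QuantumFieldTheory
open Literature.MathematicalPhysics.QuantumFieldTheory.LatticeMaxwell
open Literature.MathematicalPhysics.QuantumFieldTheory.AxialGauge

namespace Summit.QuantumFields.YangMills.Theorems.AllWindowsColdBox.DirResponse

open Summit.QuantumFields.YangMills.Theorems.WeakCouplingRates
open Summit.QuantumFields.YangMills.Theorems.AllWindowsColdBox.ShellSum

variable {H : ℕ}

/-- The plaquettes of a site set project into the site set times the `16` direction pairs. -/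
theorem plaquettesIn_subset_product (Λ : Finset (Site 4)) :
    plaquettesIn Λ ⊆ Λ ×ˢ ((Finset.univ : Finset (Fin 4)) ×ˢ (Finset.univ : Finset (Fin 4))) := by
  intro p hp
  unfold plaquettesIn at hp
  exact (Finset.mem_filter.1 hp).1

/-- **The kernel-free lattice sum over the enlarged box**: for `x ∈ {0,…,2H}⁴`,
`Σ_{q ∈ shift(dirCorner) plaquettesIn {0..2H+2}⁴} (1 + Σ_m |x_m − q.1_m|)⁻⁴ ≤ 16·(1 + 80·log(2H+3))`. -/
theorem sum_inv_pow_four_enlargedBox_le (x : Site 4) (hx : ∀ m, 0 ≤ x m ∧ x m ≤ 2 * (H : ℤ)) :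
    ∑ q ∈ (plaquettesIn (halfOpenBox 4 (2 * H + 3))).image (Plaq.shift dirCorner),
        1 / (1 + (((∑ m : Fin 4, |x m - q.1 m|) : ℤ) : ℝ)) ^ 4 ≤
      16 * (1 + 80 * Real.log ((((2 * H + 2 : ℕ)) : ℝ) + 1)) := by
  classical
  set f : (Fin 4 → ℤ) → ℝ := fun w => 1 / (1 + ∑ m : Fin 4, (|w m| : ℝ)) ^ 4 with hf
  have hf0 : ∀ w, 0 ≤ f w := fun w => by simp only [hf]; positivity
  set φ : Site 4 → (Fin 4 → ℤ) := fun y => y + dirCorner - x with hφ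
  -- the summand as `f (φ p.1)` after the shift
  have hterm : ∀ p : Plaq 4, 1 / (1 + (((∑ m : Fin 4, |x m - (Plaq.shift dirCorner p).1 m|) : ℤ) : ℝ)) ^ 4 = f (φ p.1) := by
    intro p
    simp only [hf, hφ, Plaq.shift_fst, Int.cast_sum, Int.cast_abs, Int.cast_sub, Pi.add_apply, Pi.sub_apply]
    congr 2; congr 1
    refine Finset.sum_congr rfl fun m _ => ?_
    rw [← abs_neg]; congr 1; push_cast; ring
  rw [Finset.sum_image fun p _ q _ h => Plaq.shift_injective _ h]
  simp_rw [hterm]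
  -- enlarge to all (site, direction pair) triples
  have h1 : ∑ p ∈ plaquettesIn (halfOpenBox 4 (2 * H + 3)), f (φ p.1) ≤
      ∑ p ∈ halfOpenBox 4 (2 * H + 3) ×ˢ ((Finset.univ : Finset (Fin 4)) ×ˢ (Finset.univ : Finset (Fin 4))), f (φ p.1) :=
    Finset.sum_le_sum_of_subset_of_nonneg (plaquettesIn_subset_product _) fun _ _ _ => hf0 _
  refine h1.trans ?_
  rw [Finset.sum_product]
  have hconst : ∀ y : Site 4,
      ∑ _z ∈ (Finset.univ : Finset (Fin 4)) ×ˢ (Finset.univ : Finset (Fin 4)), f (φ y) = 16 * f (φ y) := fun y => by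
    rw [Finset.sum_const, Finset.card_product, Finset.card_univ, Fintype.card_fin, nsmul_eq_mul]; norm_num
  simp_rw [hconst]
  rw [← Finset.mul_sum]
  refine mul_le_mul_of_nonneg_left ?_ (by norm_num)
  -- reindex the sites by `w = y + dirCorner − x`, which lands in the cube of radius `2H+2`
  have hφinj : Set.InjOn φ (halfOpenBox 4 (2 * H + 3) : Set (Site 4)) := by
    intro a _ b _ hab
    simp only [hφ] at hab
    have := congr_arg (fun w => w - dirCorner + x) hab
    simpa using this
  rw [← Finset.sum_image hφinj]
  refine (Finset.sum_le_sum_of_subset_of_nonneg ?_ fun _ _ _ => hf0 _).trans (sum_cube_inv_pow_four_le_log (2 * H + 2))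
  intro w hw
  obtain ⟨y, hy, rfl⟩ := Finset.mem_image.1 hw
  rw [mem_cube]
  intro m
  have hym := (mem_halfOpenBox.1 (Finset.mem_coe.1 hy)) m
  have hxm := hx m
  simp only [hφ, Pi.add_apply, Pi.sub_apply, dirCorner]
  rw [abs_le]; push_cast; constructor <;> omega

/-- **K1 ⇒ K2 (half 1 of `stub_potentialCorollaries`, without the hypothesis C)**: the dipole law of the Dirichlet box projection kernel implies the
ℓ¹ response bound at deep plaquettes, `Σ_{e free} |E_D[circ_{(x,1,2)} · s_e]| ≤ c·H·(1+log H)²`.  Both Props of the skeleton unfolded. -/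
theorem dirResponseL1_of_dipoleDecay
    (hK1 : ∃ c : ℝ, 0 < c ∧ ∀ H : ℕ, 1 ≤ H → ∀ p q : Plaq 4,
      |boxDirProjKernel H p q| ≤ c * (1 + Real.log H) / (1 + (((∑ m : Fin 4, |p.1 m - q.1 m|) : ℤ) : ℝ)) ^ 4) :
    ∃ c : ℝ, 0 < c ∧ ∀ H : ℕ, 1 ≤ H → ∀ x : Site 4,
      (∀ m : Fin 4, 8 * |x m - (H : ℤ)| ≤ (H : ℤ)) →
        ∑ e : DirFree H, |∫ s, dirCirc H (x, 1, 2) s * WithLp.ofLp s e ∂(boxDirichlet H)| ≤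
          c * (H : ℝ) * (1 + Real.log H) ^ 2 := by
  obtain ⟨c₁, hc₁, hK⟩ := hK1
  refine ⟨132 * 16 * 321 * c₁, by positivity, fun H hH x hxdeep => ?_⟩
  have hx : ∀ m, 0 ≤ x m ∧ x m ≤ 2 * (H : ℤ) := fun m => by
    have h := hxdeep m
    have h8 : |x m - H| ≤ H := by linarith [abs_nonneg (x m - (H : ℤ))]
    obtain ⟨hl, hu⟩ := abs_le.1 h8
    constructor <;> omega
  have hH' : (1 : ℝ) ≤ H := by exact_mod_cast hH
  have hlog0 : 0 ≤ Real.log H := Real.log_nonneg hH'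
  -- part 3a: response ≤ 132 H · kernel mass
  have h1 := sum_abs_cov_le_kernelMass hH (x, (1 : Fin 4), (2 : Fin 4))
  -- K1 termwise
  have h2 : ∑ q ∈ (plaquettesIn (halfOpenBox 4 (2 * H + 3))).image (Plaq.shift dirCorner), |boxDirProjKernel H (x, 1, 2) q| ≤
      c₁ * (1 + Real.log H) * ∑ q ∈ (plaquettesIn (halfOpenBox 4 (2 * H + 3))).image (Plaq.shift dirCorner),
        1 / (1 + (((∑ m : Fin 4, |x m - q.1 m|) : ℤ) : ℝ)) ^ 4 := by
    rw [Finset.mul_sum]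
    refine Finset.sum_le_sum fun q _ => ?_
    have := hK H hH (x, 1, 2) q
    rw [mul_one_div]
    exact this
  -- the lattice sum and the logarithm
  have h3 := sum_inv_pow_four_enlargedBox_le (H := H) x hx
  have hlog : Real.log ((((2 * H + 2 : ℕ)) : ℝ) + 1) ≤ 4 + Real.log H := by
    have hH0 : (0 : ℝ) < H := by linarith
    have h5 : Real.log 5 ≤ 4 := by
      have := Real.log_le_sub_one_of_pos (by norm_num : (0 : ℝ) < 5); linarith
    calc Real.log ((((2 * H + 2 : ℕ)) : ℝ) + 1) ≤ Real.log (5 * H) := by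
          apply Real.log_le_log (by positivity); push_cast; linarith
      _ = Real.log 5 + Real.log H := Real.log_mul (by norm_num) hH0.ne'
      _ ≤ 4 + Real.log H := by linarith
  have h4 : ∑ q ∈ (plaquettesIn (halfOpenBox 4 (2 * H + 3))).image (Plaq.shift dirCorner),
      1 / (1 + (((∑ m : Fin 4, |x m - q.1 m|) : ℤ) : ℝ)) ^ 4 ≤ 16 * 321 * (1 + Real.log H) := by
    refine h3.trans ?_
    nlinarith
  -- assemble
  have hS0 : 0 ≤ ∑ q ∈ (plaquettesIn (halfOpenBox 4 (2 * H + 3))).image (Plaq.shift dirCorner),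
      1 / (1 + (((∑ m : Fin 4, |x m - q.1 m|) : ℤ) : ℝ)) ^ 4 := Finset.sum_nonneg fun _ _ => by positivity
  calc ∑ e : DirFree H, |∫ s, dirCirc H (x, 1, 2) s * WithLp.ofLp s e ∂(boxDirichlet H)|
      ≤ 132 * (H : ℝ) * ∑ q ∈ (plaquettesIn (halfOpenBox 4 (2 * H + 3))).image (Plaq.shift dirCorner),
          |boxDirProjKernel H (x, 1, 2) q| := h1
    _ ≤ 132 * (H : ℝ) * (c₁ * (1 + Real.log H) * (16 * 321 * (1 + Real.log H))) := by
        refine mul_le_mul_of_nonneg_left (h2.trans ?_) (by positivity)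
        exact mul_le_mul_of_nonneg_left h4 (by positivity)
    _ = 132 * 16 * 321 * c₁ * (H : ℝ) * (1 + Real.log H) ^ 2 := by ring

end Summit.QuantumFields.YangMills.Theorems.AllWindowsColdBox.DirResponse

end
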